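import Summits.AnomalousDissipation.AnomalousDissipation.Theorems.MarginalStabilityChainStrainedLayerLawStubVorticityUniformBoundsU

/-!
# Stub `stub_vorticityUniformBounds` of line `strain-work-sum-rule` (crux `MarginalStabilityChain.StrainedLayerLaw`,
# stmt-AnomalousDissipation-3007): uniform-in-time vorticity bounds — PROVED

Support file (`--supports stmt-AnomalousDissipation-3007`) proving the registered stub `stub_vorticityUniformBounds` with
its signature verbatim: for every classical solution `(u, v, p)` of the stretched two-dimensional Navier–Stokes layer
system on `(0, ∞)` (`ν, L > 0`) with uniform exponential shear tails on compact time intervals there are `A, B, M` with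
`∫∫|ω(t)| ≤ A`, `∫∫ω(t)² ≤ B`, `∫∫|y||ω(t)| ≤ M` for all `t ≥ 1` (`ω = ∂ₓv − ∂_yu`, integrals over one period cell as
iterated Bochner integrals). Assembly of the a-priori chain: (a) Kato's `L¹`-antitonicity (tools H,
`A = ∫∫|ω(1)|`), (c′) the enstrophy bound (tools N), (b′) the first-moment bound (tools U). No uniqueness and no initial
datum are used; the constants depend on the solution. All `[folklore]`.
-/

-- `Summit.<Summit>.<Problem>` is the tree's mandated summit-side namespace (CONVENTIONS §2); for this
-- single-conjunct summit the two coincide, so the duplicate is deliberate.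
set_option linter.dupNamespace false

noncomputable section

open scoped Topology ENNReal
open Filter Set Function MeasureTheory

namespace Summit.AnomalousDissipation.AnomalousDissipation.Theorems.StrainedLayerLaw.StrainWorkSumRule

open Literature.Analysis.FluidPDE Literature.Analysis.FluidPDE.StretchedLayer
open Summit.AnomalousDissipation.AnomalousDissipation.Theorems.MarginalStabilityChainStretchedVortexRows

/-! ## The stub -/

/-- **Uniform-in-time vorticity bounds (the registered stub `stub_vorticityUniformBounds`).** For every classical
solution of the stretched two-dimensional Navier–Stokes layer system on `(0, ∞)` (`ν, L > 0`) with uniform exponential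
shear tails on compact time intervals there are `A, B, M` with, for all `t ≥ 1`,
`∫_{x ∈ (0,L]} ∫_y |ω(t)| ≤ A`, `∫∫ ω(t)² ≤ B`, `∫∫ |y||ω(t)| ≤ M` (`ω = ∂ₓv − ∂_yu`): Kato's `L¹`-antitonicity
(`A = ∫∫|ω(1)|`, tools H), the enstrophy bound (tools N) and the first-moment bound (tools U). [folklore] -/
theorem stub_vorticityUniformBounds : ∀ (ν L : ℝ), 0 < ν → 0 < L → ∀ (u v p : ℝ → ℝ → ℝ → ℝ),
    IsStretchedLayerNSSolutionOn (Ioi 0) ν 1 1 L u v p →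
    (∀ a b : ℝ, 0 < a → a < b → ExpTails (Icc a b) u v) →
      ∃ A B M : ℝ, ∀ t : ℝ, 1 ≤ t →
        (∫ x in Ioc 0 L, ∫ y, |vorticity (u t) (v t) x y|) ≤ A ∧
        (∫ x in Ioc 0 L, ∫ y, vorticity (u t) (v t) x y ^ 2) ≤ B ∧
        (∫ x in Ioc 0 L, ∫ y, |y| * |vorticity (u t) (v t) x y|) ≤ M := by
  intro ν L hν hL u v p hsol htails
  obtain ⟨B, hB⟩ := stub_vorticityUniformBounds_enstrophy ν L hν hL u v p hsol htails
  obtain ⟨M, hM⟩ := stub_vorticityUniformBounds_moment ν L hν hL u v p hsol htails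
  refine ⟨∫ x in Ioc 0 L, ∫ y, |vorticity (u 1) (v 1) x y|, B, M, fun t ht => ⟨?_, hB t ht, hM t ht⟩⟩
  exact stub_vorticityUniformBounds_kato ν L hν hL u v p hsol htails 1 t one_pos ht

end Summit.AnomalousDissipation.AnomalousDissipation.Theorems.StrainedLayerLaw.StrainWorkSumRule

end
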